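import Literature.AlgebraicGeometry.Resolution.RegularSystemOfParameters
import Summits.ResolutionOfSingularities.ResolutionOfSingularities.Theorems.WeightedInvariantHypersurfaceLocalGameEFTPointMoveDrop
import Summits.ResolutionOfSingularities.ResolutionOfSingularities.Theorems.WeightedInvariantHypersurfaceLocalGameEFTDimTwoNewton
import HarnessLib

/-!
# The e.f.t. local weighted game (H2a′), dim-2 rung I: the tangent cone (start of the assembly)

Topic: `Summits/ResolutionOfSingularities/ResolutionOfSingularities/Theorems`. Helper for the door item
`HypersurfaceCentreConstruction` (statement `stmt-ResolutionOfSingularities-19897`, route `WeightedInvariant`);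
kernel K7 (assembly), part 1 of 2, of the dim-2 design memo `L/res-type-098-w43/EFT-DIM2-DESIGN.md` v2
(ORDER (o13) of `res-L1-w43-plan-1`), for THE named rank `ι = iotaOrd` (res-type-073, p502169).

[OURS · L1 W4.3] Replaces the role of NO printed item; NOT a statement of the manuscript
[claim: Hironaka2017, status: under-review]. AI work, weaker than expert review.

## Content (namespace `LocalGameEFTDimTwo`)

`S` regular local of Krull dimension `2`, `0 ≠ f ∈ 𝔪²`, `ν = ord_𝔪 f` (`exists_order`: `2 ≤ ν`, `f ∈ 𝔪^ν ∖ 𝔪^{ν+1}`,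
`iotaOrd S f = ν`), `(x, y)` a regular system of parameters (`exists_span_pair_eq_maximalIdeal`).

* `clause_of_pointMove_lt` — PACKAGING: for the point move `u = (x, y)`, `w = (1, b)` (`b ≥ 1`) the admissibility
  conjunct of the H2a′ clause is automatic (a prime containing `x, y` is `𝔪`), so the `∃ n u w`-clause of
  `LocalWeightedDropEFT` for `ι = iotaOrd` follows from the successor-drop statement
  «`iotaOrd B_𝔫 g < ν` at every prime `𝔫 ∋ t⁻¹`, `𝔫 ⊇ 𝔪B`, off the vertex» (the conclusion shape of K7a
  `LocalGameEFTPointMove.pointMove_iotaOrd_lt_of_face`, p509576, and of K3b-iii).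
* `eval_mem_pow_succ_of_isHomogeneous` — a `ν`-form over `S` all of whose coefficients lie in `𝔪` evaluates at
  elements of `𝔪` into `𝔪^{ν+1}`.
* **`tangent_win_or_prepared`** (memo §2 case B + glue (g1)): write `f = Σ_{α ∈ Δ} a_α x^{α₀} y^{α₁} + r` with unit
  coefficients and `r ∈ 𝔪^{ν+1}` (res-type-092's `LocalGameEFTNewton.exists_unitExpansion`); the TANGENT CONE
  `F = Σ_{|α| = ν} ā_α X^α ∈ κ[X₀, X₁]` is the face polynomial of the ordinary point move `w = (1, 1)`
  (`LocalGameEFTPointMove.rho_transform`).  EITHER `F` is not `c (α X₀ + β X₁)^ν` — then res-type-078's K4b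
  (`LocalGameEFTFace.algebraMap_notMem_pow_of_isHomogeneous`) and K7a make the ordinary point move WIN (the rank
  drops at every singular successor point) — OR `F = c̄ (ᾱ X₀ + β̄ X₁)^ν`, and then for lifts `c, α̃, β̃` the element
  `y' = α̃ x + β̃ y` is a regular parameter with `f - c·y'^ν ∈ 𝔪^{ν+1}`, i.e. the position is PREPARED AT LEVEL 1
  in a regular system of parameters `(x', y')` (`x' = x` if `β̄ ≠ 0`, else `x' = y`): the start datum of the
  steepening loop of part 2 (`…EFTDimTwo.lean`), in the `𝒥_b`-currency of K5
  (`weightedMonomialIdeal ![x', y'] ![1, 1] (1 * ν + 1)`).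

## References

* J. Włodarczyk, *Functorial resolution by torus actions*, arXiv:2203.03090, §2.3.9, Lemma 4.1.7. [Wlodarczyk2022]
* H. Matsumura, *Commutative Ring Theory*, Thm. 14.2, Thm. 16.2. [Matsumura1987]
-/

noncomputable section

open IsLocalRing Literature.AlgebraicGeometry.Resolution
open Summit.ResolutionOfSingularities.ResolutionOfSingularities.Cruxes.HypersurfaceCentreConstruction.LocalEngine
  (iotaOrd iotaOrd_eq_natCast_iff)

set_option linter.dupNamespace false -- mandated namespace of this single-conjunct summit

namespace Summit.ResolutionOfSingularities.ResolutionOfSingularities.Theorems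

namespace LocalGameEFTDimTwo

variable {S : Type} [CommRing S]

/-! ### The order `ν` of the position and a regular system of parameters -/

/-- **The order of a position.** In a Noetherian local ring, `0 ≠ f ∈ 𝔪²` has an order `ν ≥ 2`:
`f ∈ 𝔪^ν ∖ 𝔪^{ν+1}` and `iotaOrd S f = ν`. [cite: ZariskiSamuel1960, Ch. VIII §1] -/
theorem exists_order [IsLocalRing S] [IsNoetherianRing S] {f : S} (hf0 : f ≠ 0)
    (hf2 : f ∈ (maximalIdeal S) ^ 2) :
    ∃ ν : ℕ, 2 ≤ ν ∧ f ∈ maximalIdeal S ^ ν ∧ f ∉ maximalIdeal S ^ (ν + 1) ∧ iotaOrd S f = ν := by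
  obtain ⟨ν, hν⟩ := ENat.ne_top_iff_exists.mp (adicOrder_ne_top hf0)
  have hmem : f ∈ maximalIdeal S ^ ν := (le_adicOrder_iff f ν).mp hν.le
  have hnot : f ∉ maximalIdeal S ^ (ν + 1) := (adicOrder_le_iff f ν).mp hν.ge
  refine ⟨ν, ?_, hmem, hnot, (iotaOrd_eq_natCast_iff S f ν).mpr ⟨hmem, hnot⟩⟩
  by_contra hlt
  exact hnot (Ideal.pow_le_pow_right (by omega) hf2)

/-- In a regular local ring of Krull dimension two, `spanFinrank 𝔪 = 2`. [cite: Matsumura1987, §14] -/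
theorem spanFinrank_eq_two [IsRegularLocalRing S] (hdim : ringKrullDim S = 2) :
    (maximalIdeal S).spanFinrank = 2 := by
  have h := IsRegularLocalRing.spanFinrank_maximalIdeal (R := S)
  rw [hdim] at h
  exact_mod_cast h

/-- In a regular local ring of Krull dimension two, `ringKrullDim S = (2 : ℕ)` (cast form used by the K5 files).
[folklore] -/
theorem ringKrullDim_eq_two_nat [IsRegularLocalRing S] (hdim : ringKrullDim S = 2) :
    ringKrullDim S = (2 : ℕ) := by
  rw [hdim]; rfl

/-- **A regular system of parameters `(x, y)`** of a regular local ring of Krull dimension two.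
[cite: Matsumura1987, §14] -/
theorem exists_span_pair_eq_maximalIdeal (S : Type) [CommRing S] [IsRegularLocalRing S] (hdim : ringKrullDim S = 2) :
    ∃ x y : S, Ideal.span {x, y} = maximalIdeal S := by
  have h := exists_regularSystemOfParameters (R := S)
  rw [spanFinrank_eq_two hdim] at h
  obtain ⟨u, hu⟩ := h
  refine ⟨u 0, u 1, ?_⟩
  rw [← hu]
  congr 1
  ext z
  simp only [Set.mem_insert_iff, Set.mem_singleton_iff, Set.mem_range, Fin.exists_fin_two, eq_comm]

/-! ### Packaging a point move into the `∃`-clause -/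

/-- **Packaging of a point move.** For `(x, y)` a regular system of parameters of a regular local ring with
`spanFinrank 𝔪 = 2`, weights `(1, b)` with `b ≥ 1`, `f ∈ 𝔪²` with `iotaOrd S f = ν`: the admissibility conjunct of
the H2a′ clause holds (a prime containing `x` and `y` is `𝔪`), so the `∃ n u w`-clause of `LocalWeightedDropEFT`
for `ι = iotaOrd` follows from «`iotaOrd B_𝔫 g < ν` at every successor prime». [OURS · L1 W4.3 · K7] -/
theorem clause_of_pointMove_lt (S : Type) [CommRing S] [IsRegularLocalRing S]
    (hd : (maximalIdeal S).spanFinrank = 2) {x y : S} (hxy : Ideal.span {x, y} = maximalIdeal S)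
    {b : ℕ} (hb : 1 ≤ b) (f : S) (hf2 : f ∈ (maximalIdeal S) ^ 2) {ν : ℕ} (hν : iotaOrd S f = ν)
    (hdrop : ∀ (𝔫 : Ideal (extReesAlgebra (weightedMonomialIdeal ![x, y] ![1, b]))) [𝔫.IsPrime],
      extReesAlgebra.tInv (weightedMonomialIdeal ![x, y] ![1, b]) ∈ 𝔫 →
      (maximalIdeal S).map (algebraMap S (extReesAlgebra (weightedMonomialIdeal ![x, y] ![1, b]))) ≤ 𝔫 →
      ¬ (extReesAlgebra.vertexIdeal (weightedMonomialIdeal ![x, y] ![1, b]) ≤ 𝔫) →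
      ∀ (a' : ℕ) (g : extReesAlgebra (weightedMonomialIdeal ![x, y] ![1, b])),
        algebraMap S (extReesAlgebra (weightedMonomialIdeal ![x, y] ![1, b])) f =
          extReesAlgebra.tInv (weightedMonomialIdeal ![x, y] ![1, b]) ^ a' * g →
        ¬ (extReesAlgebra.tInv (weightedMonomialIdeal ![x, y] ![1, b]) ∣ g) →
        algebraMap (extReesAlgebra (weightedMonomialIdeal ![x, y] ![1, b])) (Localization.AtPrime 𝔫) g ∈
          (maximalIdeal (Localization.AtPrime 𝔫)) ^ 2 →
        iotaOrd (Localization.AtPrime 𝔫)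
          (algebraMap (extReesAlgebra (weightedMonomialIdeal ![x, y] ![1, b])) (Localization.AtPrime 𝔫) g) < ν) :
    ∃ (n : ℕ) (u : Fin n → S) (w : Fin n → ℕ),
      Ideal.span (Set.range u) = maximalIdeal S ∧ (maximalIdeal S).spanFinrank = n ∧ (∃ i, 0 < w i) ∧
      (∀ (P : Ideal S) [P.IsPrime], (∀ i, 0 < w i → u i ∈ P) →
        algebraMap S (Localization.AtPrime P) f ∈ (maximalIdeal (Localization.AtPrime P)) ^ 2) ∧
      ∀ (𝔫 : Ideal (extReesAlgebra (weightedMonomialIdeal u w))) [𝔫.IsPrime],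
        extReesAlgebra.tInv (weightedMonomialIdeal u w) ∈ 𝔫 →
        (maximalIdeal S).map (algebraMap S (extReesAlgebra (weightedMonomialIdeal u w))) ≤ 𝔫 →
        ¬ (extReesAlgebra.vertexIdeal (weightedMonomialIdeal u w) ≤ 𝔫) →
        ∀ (a : ℕ) (g : extReesAlgebra (weightedMonomialIdeal u w)),
          algebraMap S (extReesAlgebra (weightedMonomialIdeal u w)) f =
            extReesAlgebra.tInv (weightedMonomialIdeal u w) ^ a * g →
          ¬ (extReesAlgebra.tInv (weightedMonomialIdeal u w) ∣ g) →
          algebraMap (extReesAlgebra (weightedMonomialIdeal u w)) (Localization.AtPrime 𝔫) g ∈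
            (maximalIdeal (Localization.AtPrime 𝔫)) ^ 2 →
          iotaOrd (Localization.AtPrime 𝔫)
              (algebraMap (extReesAlgebra (weightedMonomialIdeal u w)) (Localization.AtPrime 𝔫) g) <
            iotaOrd S f := by
  have hu : Ideal.span (Set.range ![x, y]) = maximalIdeal S := LocalGameEFTNewton.span_range_vecCons_eq hxy
  refine ⟨2, ![x, y], ![1, b], hu, hd, ⟨0, by simp⟩, ?_, ?_⟩
  · -- admissibility: a prime containing `x, y` is `𝔪`
    intro P _ hP
    have hle : maximalIdeal S ≤ P := by
      rw [← hu, Ideal.span_le]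
      rintro _ ⟨i, rfl⟩
      refine hP i ?_
      fin_cases i
      · exact Nat.one_pos
      · exact hb
    have hfP : f ∈ P ^ 2 := Ideal.pow_right_mono hle 2 hf2
    have := Ideal.mem_map_of_mem (algebraMap S (Localization.AtPrime P)) hfP
    rwa [Ideal.map_pow, Localization.AtPrime.map_eq_maximalIdeal] at this
  · rw [hν]
    exact hdrop

/-! ### Residually vanishing forms -/

/-- **A `ν`-form with coefficients in `𝔪` evaluates into `𝔪^{ν+1}`** at elements of `𝔪`. [folklore] -/
theorem eval_mem_pow_succ_of_isHomogeneous [IsLocalRing S] {d : ℕ} (u : Fin d → S)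
    (hu : ∀ i, u i ∈ maximalIdeal S) {Q : MvPolynomial (Fin d) S} {ν : ℕ} (hQ : Q.IsHomogeneous ν)
    (hcoeff : ∀ m, Q.coeff m ∈ maximalIdeal S) :
    MvPolynomial.eval u Q ∈ maximalIdeal S ^ (ν + 1) := by
  classical
  rw [MvPolynomial.eval_eq']
  refine Ideal.sum_mem _ fun m hm => ?_
  have hdeg : ∑ i, m i = ν := by
    have hw := hQ (MvPolynomial.mem_support_iff.mp hm)
    rw [Finsupp.weight_apply, Finsupp.sum_fintype _ _ (by simp)] at hw
    simpa only [Pi.one_apply, smul_eq_mul, mul_one] using hw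
  rw [pow_succ']
  refine Ideal.mul_mem_mul (hcoeff m) ?_
  rw [← hdeg, ← Finset.prod_pow_eq_pow_sum]
  exact Ideal.prod_mem_prod fun i _ => Ideal.pow_mem_pow (hu i) (m i)

/-- If `MvPolynomial.map (Ideal.Quotient.mk I) Q = 0` then every coefficient of `Q` lies in `I`. [folklore] -/
theorem coeff_mem_of_map_mk_eq_zero {σ : Type*} {I : Ideal S} {Q : MvPolynomial σ S}
    (h : MvPolynomial.map (Ideal.Quotient.mk I) Q = 0) (m : σ →₀ ℕ) : Q.coeff m ∈ I := by
  rw [← Ideal.Quotient.eq_zero_iff_mem, ← MvPolynomial.coeff_map, h, MvPolynomial.coeff_zero]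

/-! ### Monomials with `Fin 2`-function exponents -/

/-- `C c · ∏ᵢ Xᵢ^{αᵢ}` is the monomial with exponent `α`. [folklore] -/
theorem C_mul_prod_X_pow_eq_monomial {R : Type*} [CommSemiring R] {d : ℕ} (c : R) (α : Fin d → ℕ) :
    MvPolynomial.C c * ∏ i, MvPolynomial.X i ^ α i =
      MvPolynomial.monomial (Finsupp.equivFunOnFinite.symm α) c := by
  rw [MvPolynomial.monomial_eq, Finsupp.prod_fintype _ _ (fun i => pow_zero _)]
  simp

/-- The degree of a `Fin d`-function exponent. [folklore] -/
theorem degree_equivFunOnFinite_symm {d : ℕ} (α : Fin d → ℕ) :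
    (Finsupp.equivFunOnFinite.symm α).degree = ∑ i, α i := by
  rw [Finsupp.degree_eq_sum]
  simp

/-! ### The tangent cone: win, or prepared at level one -/

section Tangent

variable [IsRegularLocalRing S] (hd : (maximalIdeal S).spanFinrank = 2) {x y : S}
  (hxy : Ideal.span {x, y} = maximalIdeal S) {f : S} {ν : ℕ} (hν1 : 1 ≤ ν)
  (hfν : f ∈ maximalIdeal S ^ ν) (hfν' : f ∉ maximalIdeal S ^ (ν + 1))

include hd hxy hν1 hfν hfν'

/-- **The tangent-cone dichotomy (memo §2 case B + glue (g1)).** Let `S` be regular local with regular system of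
parameters `(x, y)` (`spanFinrank 𝔪 = 2`) and `f ∈ 𝔪^ν ∖ 𝔪^{ν+1}`, `ν ≥ 1`. EITHER the ordinary point move
`u = (x, y)`, `w = (1, 1)` drops `iotaOrd` below `ν` at every singular successor point (the tangent cone is not a
`κ`-rational `ν`-fold line; K4b + K7a), OR there are a regular system of parameters `(x', y')` and a unit `c` with
`f - c·y'^ν ∈ 𝒥₁(ν+1)(x', y') = 𝔪^{ν+1}` (the tangent cone is the `ν`-fold line `y' = 0`: prepared at level `1`).
[OURS · L1 W4.3 · K7] [cite: Wlodarczyk2022, §2.3.9] -/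
theorem tangent_win_or_prepared :
    (∀ (𝔫 : Ideal (extReesAlgebra (weightedMonomialIdeal ![x, y] ![1, 1]))) [𝔫.IsPrime],
      extReesAlgebra.tInv (weightedMonomialIdeal ![x, y] ![1, 1]) ∈ 𝔫 →
      (maximalIdeal S).map (algebraMap S (extReesAlgebra (weightedMonomialIdeal ![x, y] ![1, 1]))) ≤ 𝔫 →
      ¬ (extReesAlgebra.vertexIdeal (weightedMonomialIdeal ![x, y] ![1, 1]) ≤ 𝔫) →
      ∀ (a' : ℕ) (g : extReesAlgebra (weightedMonomialIdeal ![x, y] ![1, 1])),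
        algebraMap S (extReesAlgebra (weightedMonomialIdeal ![x, y] ![1, 1])) f =
          extReesAlgebra.tInv (weightedMonomialIdeal ![x, y] ![1, 1]) ^ a' * g →
        ¬ (extReesAlgebra.tInv (weightedMonomialIdeal ![x, y] ![1, 1]) ∣ g) →
        algebraMap (extReesAlgebra (weightedMonomialIdeal ![x, y] ![1, 1])) (Localization.AtPrime 𝔫) g ∈
          (maximalIdeal (Localization.AtPrime 𝔫)) ^ 2 →
        iotaOrd (Localization.AtPrime 𝔫)
          (algebraMap (extReesAlgebra (weightedMonomialIdeal ![x, y] ![1, 1])) (Localization.AtPrime 𝔫) g) < ν) ∨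
    ∃ x' y' c : S, Ideal.span {x', y'} = maximalIdeal S ∧ IsUnit c ∧
      f - c * y' ^ ν ∈ weightedMonomialIdeal ![x', y'] ![1, 1] (1 * ν + 1) := by
  classical
  -- notation and the unit expansion of `f` to order `ν + 1`
  have hu : Ideal.span (Set.range ![x, y]) = maximalIdeal S := LocalGameEFTNewton.span_range_vecCons_eq hxy
  have humem : ∀ i, ![x, y] i ∈ maximalIdeal S := fun i => hu ▸ Ideal.subset_span ⟨i, rfl⟩
  have hw : ∀ i, 0 < (![1, 1] : Fin 2 → ℕ) i := Fin.forall_fin_two.2 ⟨Nat.one_pos, Nat.one_pos⟩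
  have hdimS : ringKrullDim S = (2 : ℕ) := by
    rw [← IsRegularLocalRing.spanFinrank_maximalIdeal, hd]
  obtain ⟨Δ, a, hunit, -, hr⟩ := LocalGameEFTNewton.exists_unitExpansion ![x, y] hu f (ν + 1)
  obtain ⟨hge, α₀, hα₀, hα₀ν⟩ :=
    LocalGameEFTNewton.exists_degree_eq_of_not_mem_pow ![x, y] hu hdimS hunit hr hfν hfν' (Nat.lt_succ_self ν)
  have hwt : ∀ α : Fin 2 → ℕ, ∑ i, (![1, 1] : Fin 2 → ℕ) i * α i = ∑ i, α i := fun α => by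
    simp [Fin.sum_univ_two]
  have hm : ∀ α ∈ Δ, ν ≤ ∑ i, (![1, 1] : Fin 2 → ℕ) i * α i := fun α hα => by rw [hwt]; exact hge α hα
  have hN : 0 < ν + 1 := Nat.succ_pos ν
  have hf : f = ∑ α ∈ Δ, a α * ∏ i, ![x, y] i ^ α i + (f - ∑ α ∈ Δ, a α * ∏ i, ![x, y] i ^ α i) :=
    (add_sub_cancel _ f).symm
  -- the residue field and the tangent cone `F`
  set I : Ideal S := Ideal.span (Set.range ![x, y]) with hI
  haveI hImax : I.IsMaximal := by rw [hu]; exact IsLocalRing.maximalIdeal.isMaximal S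
  set F : MvPolynomial (Fin 2) (S ⧸ I) := ∑ α ∈ Δ.filter (fun α => ∑ i, (![1, 1] : Fin 2 → ℕ) i * α i = ν),
    MvPolynomial.C (Ideal.Quotient.mk I (a α)) * ∏ i, MvPolynomial.X i ^ α i with hFdef
  have hρ : LocalGameEFTPointMove.rho ![x, y] ![1, 1] hu hd hw
      (LocalGameEFTPointMove.transform ![x, y] ![1, 1] hu hw Δ a ν hN hr) = F :=
    LocalGameEFTPointMove.rho_transform ![x, y] ![1, 1] hu hd hw Δ a ν hN hr hm (Nat.lt_succ_self ν)
  have hFmon : F = ∑ α ∈ Δ.filter (fun α => ∑ i, (![1, 1] : Fin 2 → ℕ) i * α i = ν),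
      MvPolynomial.monomial (Finsupp.equivFunOnFinite.symm α) (Ideal.Quotient.mk I (a α)) := by
    rw [hFdef]
    exact Finset.sum_congr rfl fun α _ => C_mul_prod_X_pow_eq_monomial _ α
  have hFhom : F.IsHomogeneous ν := by
    rw [hFmon]
    refine MvPolynomial.IsHomogeneous.sum _ _ _ fun α hα => MvPolynomial.isHomogeneous_monomial _ ?_
    rw [degree_equivFunOnFinite_symm, ← hwt]
    exact (Finset.mem_filter.mp hα).2
  by_cases hcone : ∃ c α β : S ⧸ I, F = MvPolynomial.C c *
      (MvPolynomial.C α * MvPolynomial.X 0 + MvPolynomial.C β * MvPolynomial.X 1) ^ ν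
  swap
  · -- case B: the tangent cone is not a rational `ν`-fold line ⇒ the ordinary point move wins
    left
    letI : Field (S ⧸ I) := Ideal.Quotient.field I
    refine LocalGameEFTPointMove.pointMove_iotaOrd_lt_of_face ![x, y] ![1, 1] hu hd hw Δ a ν hN hr hm
      (Nat.lt_succ_self ν) hf ν fun 𝔫' _ hV' => ?_
    rw [hρ]
    refine LocalGameEFTFace.algebraMap_notMem_pow_of_isHomogeneous hν1 hFhom hcone 𝔫' fun hle => hV' ?_
    rw [Ideal.span_le]
    rintro _ ⟨i, rfl⟩
    fin_cases i
    · exact hle (Ideal.subset_span (by simp))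
    · exact hle (Ideal.subset_span (by simp))
  · -- the tangent cone is `c̄ (ᾱ X₀ + β̄ X₁)^ν`: prepared at level one after a linear recoordination
    right
    obtain ⟨cb, αb, βb, hFeq⟩ := hcone
    -- `F ≠ 0`: the coefficient at `α₀` is the residue of a unit
    have hcoeffF : F.coeff (Finsupp.equivFunOnFinite.symm α₀) = Ideal.Quotient.mk I (a α₀) := by
      rw [hFmon, MvPolynomial.coeff_sum, Finset.sum_eq_single α₀
        (fun α' _ hne => by
          rw [MvPolynomial.coeff_monomial, if_neg]
          exact fun h => hne (Finsupp.equivFunOnFinite.symm.injective h))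
        (fun h => absurd (Finset.mem_filter.mpr ⟨hα₀, by rw [hwt, hα₀ν]⟩) h),
        MvPolynomial.coeff_monomial, if_pos rfl]
    have hres_ne : ∀ {s : S}, IsUnit s → Ideal.Quotient.mk I s ≠ 0 := fun {s} hs h0 => by
      rw [Ideal.Quotient.eq_zero_iff_mem, hu] at h0
      exact (mem_maximalIdeal _).mp h0 hs
    have hF0 : F ≠ 0 := fun h0 => by
      have h := hcoeffF
      rw [h0, MvPolynomial.coeff_zero] at h
      exact hres_ne (hunit α₀ hα₀) h.symm
    have hcb0 : cb ≠ 0 := by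
      rintro rfl
      exact hF0 (by rw [hFeq, map_zero, zero_mul])
    have hαβ : αb ≠ 0 ∨ βb ≠ 0 := by
      by_contra h
      push Not at h
      obtain ⟨rfl, rfl⟩ := h
      exact hF0 (by rw [hFeq, map_zero, zero_mul, zero_mul, add_zero, zero_pow (by omega), mul_zero])
    -- lifts
    obtain ⟨c, rfl⟩ := Ideal.Quotient.mk_surjective cb
    obtain ⟨al, rfl⟩ := Ideal.Quotient.mk_surjective αb
    obtain ⟨be, rfl⟩ := Ideal.Quotient.mk_surjective βb
    have hunit_of : ∀ {s : S}, Ideal.Quotient.mk I s ≠ 0 → IsUnit s := fun {s} hs => by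
      by_contra hns
      exact hs (Ideal.Quotient.eq_zero_iff_mem.mpr (by rw [hu]; exact (mem_maximalIdeal _).mpr hns))
    have hcunit : IsUnit c := hunit_of hcb0
    -- the form `Q = Σ_{|α| = ν} a_α X^α - c (α̃ X₀ + β̃ X₁)^ν` vanishes residually
    set y' : S := al * x + be * y with hy'
    set Q : MvPolynomial (Fin 2) S :=
      ∑ α ∈ Δ.filter (fun α => ∑ i, (![1, 1] : Fin 2 → ℕ) i * α i = ν),
        MvPolynomial.monomial (Finsupp.equivFunOnFinite.symm α) (a α) -
      MvPolynomial.C c * (MvPolynomial.C al * MvPolynomial.X 0 + MvPolynomial.C be * MvPolynomial.X 1) ^ ν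
      with hQ
    have hQmap : MvPolynomial.map (Ideal.Quotient.mk I) Q = 0 := by
      rw [hQ, map_sub, map_sum]
      simp_rw [MvPolynomial.map_monomial]
      rw [← hFmon, hFeq, map_mul, map_pow, map_add, map_mul, map_mul, MvPolynomial.map_C, MvPolynomial.map_C,
        MvPolynomial.map_C, MvPolynomial.map_X, MvPolynomial.map_X, sub_self]
    have hQhom : Q.IsHomogeneous ν := by
      rw [hQ]
      refine MvPolynomial.IsHomogeneous.sub ?_ ?_
      · refine MvPolynomial.IsHomogeneous.sum _ _ _ fun α hα => MvPolynomial.isHomogeneous_monomial _ ?_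
        rw [degree_equivFunOnFinite_symm, ← hwt]
        exact (Finset.mem_filter.mp hα).2
      · have hlin : (MvPolynomial.C al * MvPolynomial.X 0 + MvPolynomial.C be * MvPolynomial.X 1 :
            MvPolynomial (Fin 2) S).IsHomogeneous 1 :=
          (MvPolynomial.isHomogeneous_C_mul_X al 0).add (MvPolynomial.isHomogeneous_C_mul_X be 1)
        simpa only [one_mul] using (hlin.pow ν).C_mul c
    have hQeval : MvPolynomial.eval ![x, y] Q ∈ maximalIdeal S ^ (ν + 1) :=
      eval_mem_pow_succ_of_isHomogeneous ![x, y] humem hQhom fun m => hu ▸ coeff_mem_of_map_mk_eq_zero hQmap m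
    have hQeval' : MvPolynomial.eval ![x, y] Q =
        ∑ α ∈ Δ.filter (fun α => ∑ i, (![1, 1] : Fin 2 → ℕ) i * α i = ν), a α * ∏ i, ![x, y] i ^ α i -
          c * y' ^ ν := by
      rw [hQ, map_sub, map_sum]
      simp_rw [LocalGameEFTNewton.eval_monomial_equivFunOnFinite_symm]
      congr 1
      simp [hy']
    -- `f - c y'^ν ∈ 𝔪^{ν+1}`
    have hhigh : ∑ α ∈ Δ.filter (fun α => ¬ ∑ i, (![1, 1] : Fin 2 → ℕ) i * α i = ν),
        a α * ∏ i, ![x, y] i ^ α i ∈ maximalIdeal S ^ (ν + 1) := by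
      refine Ideal.sum_mem _ fun α hα => Ideal.mul_mem_left _ _ ?_
      obtain ⟨hαΔ, hne⟩ := Finset.mem_filter.mp hα
      have hgt : ν + 1 ≤ ∑ i, α i :=
        Nat.lt_of_le_of_ne (hge α hαΔ) fun h => hne (by rw [hwt]; exact h.symm)
      exact Ideal.pow_le_pow_right hgt (LocalGameEFTNewton.prod_pow_mem_pow ![x, y] hu α)
    have hprep : f - c * y' ^ ν ∈ maximalIdeal S ^ (ν + 1) := by
      have hsplit : f - c * y' ^ ν = (f - ∑ α ∈ Δ, a α * ∏ i, ![x, y] i ^ α i) +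
          ∑ α ∈ Δ.filter (fun α => ¬ ∑ i, (![1, 1] : Fin 2 → ℕ) i * α i = ν), a α * ∏ i, ![x, y] i ^ α i +
          MvPolynomial.eval ![x, y] Q := by
        rw [hQeval', ← Finset.sum_filter_add_sum_filter_not Δ (fun α => ∑ i, (![1, 1] : Fin 2 → ℕ) i * α i = ν)]
        ring
      rw [hsplit]
      exact Ideal.add_mem _ (Ideal.add_mem _ hr hhigh) hQeval
    -- the new regular system of parameters
    rcases hαβ.symm with hβ | hα
    · -- `β̄ ≠ 0`: `(x, y')`
      have hbe : IsUnit be := hunit_of hβ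
      have hspan : Ideal.span {x, y'} = maximalIdeal S := by
        rw [← hxy]
        apply le_antisymm
        · rw [Ideal.span_le, Set.insert_subset_iff, Set.singleton_subset_iff]
          exact ⟨Ideal.subset_span (by simp), Ideal.mem_span_pair.mpr ⟨al, be, by rw [hy']⟩⟩
        · rw [Ideal.span_le, Set.insert_subset_iff, Set.singleton_subset_iff]
          refine ⟨Ideal.subset_span (by simp), Ideal.mem_span_pair.mpr ⟨-(↑hbe.unit⁻¹ * al), ↑hbe.unit⁻¹, ?_⟩⟩
          rw [hy', mul_add, ← mul_assoc, ← mul_assoc, IsUnit.val_inv_mul, one_mul]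
          ring
      exact ⟨x, y', c, hspan, hcunit,
        LocalGameEFTSteepening.sub_mem_weightedMonomialIdeal_one_of_sub_mem_pow hspan hprep⟩
    · -- `ᾱ ≠ 0`: `(y, y')`
      have hal : IsUnit al := hunit_of hα
      have hspan : Ideal.span {y, y'} = maximalIdeal S := by
        rw [← hxy]
        apply le_antisymm
        · rw [Ideal.span_le, Set.insert_subset_iff, Set.singleton_subset_iff]
          exact ⟨Ideal.subset_span (by simp), Ideal.mem_span_pair.mpr ⟨al, be, by rw [hy']⟩⟩
        · rw [Ideal.span_le, Set.insert_subset_iff, Set.singleton_subset_iff]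
          refine ⟨Ideal.mem_span_pair.mpr ⟨-(↑hal.unit⁻¹ * be), ↑hal.unit⁻¹, ?_⟩, Ideal.subset_span (by simp)⟩
          rw [hy', mul_add, ← mul_assoc, ← mul_assoc, IsUnit.val_inv_mul, one_mul]
          ring
      exact ⟨y, y', c, hspan, hcunit,
        LocalGameEFTSteepening.sub_mem_weightedMonomialIdeal_one_of_sub_mem_pow hspan hprep⟩

end Tangent

end LocalGameEFTDimTwo

end Summit.ResolutionOfSingularities.ResolutionOfSingularities.Theorems

end
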